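import Mathlib

/-!
# Route GirthSidon — crux `PolySwallowForcesShortRelation` (stmt-ValiantsHypothesis-6537), line
`two_ended_honesty`: the LOW-HEIGHT sub-regime (pigeonhole on 30-fold sums)

A relation-free (`B₃₀`) exponent vector is astronomically spread out: if all `d_i ≤ H` and
`30·H + 1 < C(m+29, 30)` (the number of 30-element multisets of indices), two distinct 30-multisets have
the same `d`-sum (`relation_of_height`).  For a quadratic polynomial swallowing `Γ_i(y) = x^{d_i}` with
`deg y_j ≤ H` for all `j` one has `d_i ≤ 2H` (`natDegree_aeval_le_of_totalDegree_le_two`), so the residual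
stubs of the line (`stub_doublyBornTargets`, `stub_totallyBornTargets`) hold trivially unless
`max_j deg y_j > (C(m+29,30) − 1)/60 ≈ m^{30}/(60·30!)` (`relation_of_low_degree_sources`): a counterexample
needs sources of degree polynomially huge in `m` (exponent 30).  No girth, no valuations; bookkeeping only.
VP ≠ VNP is not moved. [folklore]
-/

set_option linter.dupNamespace false

namespace Summit.ValiantsHypothesis.ValiantsHypothesis.Theorems

open Polynomial

namespace PolySwallowHeight

/-- **Pigeonhole on 30-fold sums.**  If `d_i ≤ H` for all `i < m` and `30 H + 1 < C(m+29, 30)`, two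
distinct multisets of exactly `30` indices have equal `d`-sums. [folklore] -/
theorem relation_of_height {m H : ℕ} (d : Fin m → ℕ) (hd : ∀ i, d i ≤ H)
    (hm : 30 * H + 1 < Nat.choose (m + 29) 30) :
    ∃ S T : Multiset (Fin m), S ≠ T ∧ Multiset.card S ≤ 30 ∧ Multiset.card T ≤ 30 ∧
      (S.map d).sum = (T.map d).sum := by
  classical
  -- sums of 30-multisets are at most 30 H
  have hsum : ∀ S : Sym (Fin m) 30, ((S : Multiset (Fin m)).map d).sum < 30 * H + 1 := by
    intro S
    have h := Multiset.sum_le_card_nsmul ((S : Multiset (Fin m)).map d) H (by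
      intro x hx
      obtain ⟨i, -, rfl⟩ := Multiset.mem_map.mp hx
      exact hd i)
    simp only [Multiset.card_map, Sym.card_coe, smul_eq_mul] at h
    omega
  let F : Sym (Fin m) 30 → Fin (30 * H + 1) := fun S => ⟨_, hsum S⟩
  have hcard : Fintype.card (Fin (30 * H + 1)) < Fintype.card (Sym (Fin m) 30) := by
    rw [Fintype.card_fin, Sym.card_sym_eq_multichoose, Fintype.card_fin, Nat.multichoose_eq]
    exact hm
  obtain ⟨S, T, hne, hST⟩ := Fintype.exists_ne_map_eq_of_card_lt F hcard
  refine ⟨S, T, fun h => hne (Subtype.ext h), by simp, by simp, ?_⟩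
  simpa [F] using congrArg Fin.val hST

/-- Degree bookkeeping: for `p` of total degree `≤ 2` and polynomials `y_j` of degree `≤ H`,
`deg p(y) ≤ 2H`. [folklore] -/
theorem natDegree_aeval_le_of_totalDegree_le_two {K : Type*} [Field K] {σ : Type*} (y : σ → K[X])
    (H : ℕ) (hy : ∀ j, (y j).natDegree ≤ H) (p : MvPolynomial σ K) (hp : p.totalDegree ≤ 2) :
    (MvPolynomial.aeval y p).natDegree ≤ 2 * H := by
  classical
  rw [p.as_sum, map_sum (MvPolynomial.aeval y)]
  refine Polynomial.natDegree_sum_le_of_forall_le _ _ fun e he => ?_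
  rw [MvPolynomial.aeval_monomial, Polynomial.algebraMap_eq]
  refine le_trans (Polynomial.natDegree_C_mul_le _ _) ?_
  rw [Finsupp.prod]
  refine le_trans (Polynomial.natDegree_prod_le _ _) ?_
  have hdeg : (e.sum fun _ k => k) ≤ 2 := le_trans (MvPolynomial.le_totalDegree he) hp
  rw [Finsupp.sum] at hdeg
  calc ∑ j ∈ e.support, (y j ^ e j).natDegree ≤ ∑ j ∈ e.support, e j * H := by
        refine Finset.sum_le_sum fun j _ => le_trans (Polynomial.natDegree_pow_le) ?_
        exact Nat.mul_le_mul_left _ (hy j)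
    _ = (∑ j ∈ e.support, e j) * H := by rw [Finset.sum_mul]
    _ ≤ 2 * H := Nat.mul_le_mul_right _ hdeg

/-- **Low-height sub-regime of the line's residual stubs.**  A quadratic polynomial swallowing
`Γ_i(y) = x^{d_i}` whose sources all have degree `≤ H`, with `60 H + 1 < C(m+29, 30)`, has a relation of
length `≤ 30` (regardless of honesty): `d_i = deg x^{d_i} = deg Γ_i(y) ≤ 2H` and pigeonhole. [folklore] -/
theorem relation_of_low_degree_sources {m s H : ℕ} (d : Fin m → ℕ)
    (Γ : Fin m → MvPolynomial (Fin s) ℂ) (y : Fin s → Polynomial ℂ)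
    (hΓ : ∀ i, (Γ i).totalDegree ≤ 2) (hy : ∀ i, MvPolynomial.aeval y (Γ i) = Polynomial.X ^ d i)
    (hH : ∀ j, (y j).natDegree ≤ H) (hm : 60 * H + 1 < Nat.choose (m + 29) 30) :
    ∃ S T : Multiset (Fin m), S ≠ T ∧ Multiset.card S ≤ 30 ∧ Multiset.card T ≤ 30 ∧
      (S.map d).sum = (T.map d).sum := by
  refine relation_of_height d (H := 2 * H) (fun i => ?_) (by omega)
  have h := natDegree_aeval_le_of_totalDegree_le_two y H hH (Γ i) (hΓ i)
  rwa [hy i, Polynomial.natDegree_pow, Polynomial.natDegree_X, mul_one] at h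

end PolySwallowHeight

end Summit.ValiantsHypothesis.ValiantsHypothesis.Theorems
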